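import Summits.QuantumFields.YangMills.Theorems.FluctuationComparisonRegPrIntLS2BetaPosCollarCoverOfTubeChart
import HarnessLib

/-!
# S2β · POS∘ — THE TAYLOR HALF (T5): THE COVER ROW FOR A PLAIN GAUGE × SLICE PARAMETRISATION (Landau-slice shape), from its surjectivity row alone

Cell `ym3-torus` (YM ladder rung R3 = continuum `SU(2)` Yang–Mills on the three-torus at fixed lattice data — a RUNG: NOT d = 4, NOT infinite volume,
NOT a mass gap, NOT Clay).  Width seat `ym3-torus-px21` (gen 18); the (T)-chain of px8 g18's pen «Taylor half» (✓(T1) p793318 … ✓(T2c) p795315; (T3), (T4)).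
Crux `stmt-QuantumFields-20520` (`…Theses.UnitScaleTilt.FluctuationComparisonRegPrIntL`), LINE g18-1 S2β; `--kind proof --supports stmt-QuantumFields-20520 --as helper`, count-neutral,
DEFINITION-FREE (0 `def`, 0 `instance`, 0 `notation`, 0 `sorry`, default heartbeats).

WHY.  (T2b)'s cover is written for the tube chart of record `Θ (z, y) = pivotAct (e z) (σ y)` (residual × pivot factor, tree-gauge transversal, fibred re-solve + RECOGNITION).  The 19200 lineage's
(142) letters (px17 g15's LOCATE-CURV-IN-19200: ✓`hcoS_holds`, ✓`hN06_holds`) live on print's LANDAU slice `X ↦ W·e^{iX}` acted on by print's group (4) — a PLAIN `gaugeAct` of residual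
transformations on a slice, with no pivot factor and no re-solve.  For that shape the cover row of (T2a)∕(T4) needs NOTHING but the slice's SURJECTIVITY row `𝓝 U₀ ≤ map Θ (𝓝 0)` for
`Θ (l, y) := (g l) • Ψ y` (`g l` residual) — (T2a) §2 puts a residual translate of every near-orbit `U` in `Θ '' (univ ×ˢ s)`, and `w • U = (g l) • Ψ y` unwinds to `U = (w⁻¹ g l) • Ψ y`.  If moreover
`descendTo` is continuous near `U₀` ((T2d)), the slice point `Ψ y` so produced lies IN THE FIBRE whenever `U ∈ closure (fibre V ∩ histGood)` — which is how the averaging condition (20) on the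
exponent is recovered from `U`, so that (T4) §2's «cover into the set `S := {y | Ψ y ∈ fibre V}`» holds.
* §1 ★★★ `cover_of_gaugeSlice` — the cover row for `Ψ` from the surjectivity row of `(l, y) ↦ (g l) • Ψ y` (any `U`, no fibre hypothesis);
  ★★★ `cover_of_gaugeSlice_fibre` — the same for `U ∈ closure (fibre V ∩ histGood)` with `Ψ y ∈ fibre V` recorded (`hcont`), i.e. (T4) §2's cover INTO `S ⊇ {y | Ψ y ∈ fibre V}`.
The surjectivity row itself (per datum: the Landau slice theorem relative to `W` — Hodge decomposition `Y = D_W λ + X`, `R D*_W X = 0`, `λ` rooted, + the open-mapping theorem) is NOT proved here.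

HONEST: topology∕bookkeeping; the surjectivity row, the growth letters (HESS∘ ∕ CURV∘ + (142)) and ISOL∘(δ) are DISPLAYED where used; TUBE-REG∘, GAP♯∘, GAP♭, EXW∘, S2β, crux 20520 NOT proved;
no summit statement is proved by a helper; finite-volume ∕ conditional; rung R3 = SU(2) YM₃ on T³ — NOT d = 4, NOT infinite volume, NOT a mass gap, NOT Clay; the Yang–Mills mass gap is
NOT proved.  Sorry-free, axioms standard.

References: T. Bałaban, CMP **102** (1985) 277–309 [Balaban1985Variational] ((4) p.278, (19)–(21) p.281, (142) p.299); CMP **99** (1985) 75–102 [Balaban1985RegularSpaces] (Lemma 1 (1.24)–(1.26)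
pp.79–80, Thm 2 p.83); CMP **102** (1985) 255–275 [Balaban1985UV3] ((12)–(13) p.259).
-/

set_option autoImplicit false

noncomputable section

namespace Summit.QuantumFields.YangMills.Theorems.FluctuationComparisonRegPrIntLS2BetaCoverOfGaugeSlice

open Set Filter Topology Function
open scoped Matrix.Norms.L2Operator
open Literature.MathematicalPhysics.QuantumFieldTheory.Balaban1983to89
open Literature.MathematicalPhysics.QuantumFieldTheory.Balaban1983to89.T3ContinuumYM3Torus
open Literature.MathematicalPhysics.QuantumFieldTheory.Balaban1983to89.T3UnitLawDensityEML (ℰp)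
open Literature.MathematicalPhysics.QuantumFieldTheory.Balaban1983to89.T3UnitScaleTilt
open Literature.MathematicalPhysics.QuantumFieldTheory.Balaban1983to89.T3TiltDescent
open Literature.MathematicalPhysics.QuantumFieldTheory.Balaban1983to89.T3ConstrainedMinimiser (fibre)
open Literature.MathematicalPhysics.QuantumFieldTheory.Balaban1983to89.T4Continuum
open scoped Literature.MathematicalPhysics.QuantumFieldTheory.Balaban1983to89.T3OrbitAverage
open Summit.QuantumFields.YangMills.Theorems.FluctuationComparisonRegPrIntLS2BetaResidualGauge
open Summit.QuantumFields.YangMills.Theorems.FluctuationComparisonRegPrIntLS2BetaPosCollarOfGrowthRow (exists_orbitDist_le_imp_gaugeAct_mem)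
open Summit.QuantumFields.YangMills.Theorems.FluctuationComparisonRegPrIntLS2BetaPosCollarCoverOfTubeChart (mem_fibre_of_mem_closure_of_continuousAt gaugeAct_mem_closure_inter)

variable (F : T3Family) {J K : ℕ} (hJK : J ≤ K)

/-- ★★★ **THE COVER ROW FOR A GAUGE × SLICE PARAMETRISATION, FROM SURJECTIVITY ALONE.**  `Θ (l, y) := (g l) • Ψ y` with every `g l` residual and `𝓝 U₀ ≤ map Θ (𝓝 0)`.  Then for every
neighbourhood `s` of `0` there is `r > 0` such that EVERY field `U` at orbit distance `≤ r` from the residual orbit of `U₀` is `w • Ψ y` with `y ∈ s`, `w` residual.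
[cite: Balaban1985Variational, (4) p.278 and (19)-(21) p.281; Balaban1985RegularSpaces, Lemma 1 (1.24)-(1.26) pp.79-80; Balaban1985UV3, (12)-(13) p.259] -/
theorem cover_of_gaugeSlice {U₀ : GaugeField (F.P K) 0 (Matrix.specialUnitaryGroup (Fin 2) ℂ)}
    {Λ Y : Type*} [TopologicalSpace Λ] [Zero Λ] [TopologicalSpace Y] [Zero Y]
    (g : Λ → Site (F.P K) 0 → Matrix.specialUnitaryGroup (Fin 2) ℂ)
    (hg : ∀ l, ∀ U'' : GaugeField (F.P K) 0 (Matrix.specialUnitaryGroup (Fin 2) ℂ),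
      descendTo F ℰp J K hJK (GaugeField.gaugeAct (g l) U'') = descendTo F ℰp J K hJK U'')
    (Ψ : Y → GaugeField (F.P K) 0 (Matrix.specialUnitaryGroup (Fin 2) ℂ))
    (hΘ : 𝓝 U₀ ≤ map (fun p : Λ × Y => GaugeField.gaugeAct (g p.1) (Ψ p.2)) (𝓝 0)) :
    ∀ s ∈ 𝓝 (0 : Y), ∃ r : ℝ, 0 < r ∧ ∀ U : GaugeField (F.P K) 0 (Matrix.specialUnitaryGroup (Fin 2) ℂ),
      (⨅ w' : {w : Site (F.P K) 0 → Matrix.specialUnitaryGroup (Fin 2) ℂ |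
          ∀ U : GaugeField (F.P K) 0 (Matrix.specialUnitaryGroup (Fin 2) ℂ),
            descendTo F ℰp J K hJK (GaugeField.gaugeAct w U) = descendTo F ℰp J K hJK U},
        ∑ ℓ : PBond (F.P K) 0,
          dist1 (U ℓ * ((GaugeField.gaugeAct (w' : Site (F.P K) 0 → Matrix.specialUnitaryGroup (Fin 2) ℂ) U₀) ℓ)⁻¹) ^ 2) ≤ r →
      ∃ y ∈ s, ∃ w : Site (F.P K) 0 → Matrix.specialUnitaryGroup (Fin 2) ℂ,
        (∀ U'' : GaugeField (F.P K) 0 (Matrix.specialUnitaryGroup (Fin 2) ℂ),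
            descendTo F ℰp J K hJK (GaugeField.gaugeAct w U'') = descendTo F ℰp J K hJK U'') ∧
          U = GaugeField.gaugeAct w (Ψ y) := by
  intro s hs
  have hT : (fun p : Λ × Y => GaugeField.gaugeAct (g p.1) (Ψ p.2)) '' (univ ×ˢ s) ∈ 𝓝 U₀ := hΘ (image_mem_map (prod_mem_nhds univ_mem hs))
  obtain ⟨r, hr, hnear⟩ := exists_orbitDist_le_imp_gaugeAct_mem F hJK U₀ hT
  refine ⟨r, hr, fun U hUr => ?_⟩
  obtain ⟨w, hw, hWT⟩ := hnear U hUr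
  obtain ⟨⟨l, y⟩, ⟨-, hy⟩, hW⟩ := hWT
  dsimp only at hW
  refine ⟨y, hy, w⁻¹ * g l, residual_mul F hJK (residual_inv F hJK hw) (hg l), ?_⟩
  rw [gaugeAct_mul_eq, hW, gaugeAct_inv_gaugeAct]

/-- ★★★ **THE SAME ON THE CLOSED GOOD FIBRE, WITH THE SLICE POINT IN THE FIBRE** (`descendTo` continuous near `U₀`, (T2d)): for `U ∈ closure (fibre V ∩ histGood)` at small orbit distance,
`U = w • Ψ y` with `y ∈ s`, `w` residual AND `Ψ y ∈ fibre V` — the averaging condition on the slice parameter is READ OFF the field (print's (20) for the exponent of a fibre point), i.e. (T4)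
§2's cover into any `S ⊇ {y | Ψ y ∈ fibre V}`. [cite: Balaban1985Variational, (4) p.278 and (20) p.281; Balaban1985UV3, (12)-(13) p.259] -/
theorem cover_of_gaugeSlice_fibre {θ : ℕ → ℝ} {V : GaugeField (F.P J) 0 (Matrix.specialUnitaryGroup (Fin 2) ℂ)}
    {U₀ : GaugeField (F.P K) 0 (Matrix.specialUnitaryGroup (Fin 2) ℂ)}
    (hcont : ∀ᶠ W in 𝓝 U₀, ContinuousAt (descendTo F ℰp J K hJK) W)
    {Λ Y : Type*} [TopologicalSpace Λ] [Zero Λ] [TopologicalSpace Y] [Zero Y]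
    (g : Λ → Site (F.P K) 0 → Matrix.specialUnitaryGroup (Fin 2) ℂ)
    (hg : ∀ l, ∀ U'' : GaugeField (F.P K) 0 (Matrix.specialUnitaryGroup (Fin 2) ℂ),
      descendTo F ℰp J K hJK (GaugeField.gaugeAct (g l) U'') = descendTo F ℰp J K hJK U'')
    (Ψ : Y → GaugeField (F.P K) 0 (Matrix.specialUnitaryGroup (Fin 2) ℂ))
    (hΘ : 𝓝 U₀ ≤ map (fun p : Λ × Y => GaugeField.gaugeAct (g p.1) (Ψ p.2)) (𝓝 0))
    (S : Set Y) (hS : ∀ y, Ψ y ∈ fibre F ℰp J K hJK V → y ∈ S) :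
    ∀ s ∈ 𝓝 (0 : Y), ∃ r : ℝ, 0 < r ∧
      ∀ U ∈ closure (fibre F ℰp J K hJK V ∩ histGood F ℰp θ K J),
        (⨅ w' : {w : Site (F.P K) 0 → Matrix.specialUnitaryGroup (Fin 2) ℂ |
            ∀ U : GaugeField (F.P K) 0 (Matrix.specialUnitaryGroup (Fin 2) ℂ),
              descendTo F ℰp J K hJK (GaugeField.gaugeAct w U) = descendTo F ℰp J K hJK U},
          ∑ ℓ : PBond (F.P K) 0,
            dist1 (U ℓ * ((GaugeField.gaugeAct (w' : Site (F.P K) 0 → Matrix.specialUnitaryGroup (Fin 2) ℂ) U₀) ℓ)⁻¹) ^ 2) ≤ r →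
        ∃ y ∈ s ∩ S, ∃ w : Site (F.P K) 0 → Matrix.specialUnitaryGroup (Fin 2) ℂ,
          (∀ U'' : GaugeField (F.P K) 0 (Matrix.specialUnitaryGroup (Fin 2) ℂ),
              descendTo F ℰp J K hJK (GaugeField.gaugeAct w U'') = descendTo F ℰp J K hJK U'') ∧
            U = GaugeField.gaugeAct w (Ψ y) := by
  intro s hs
  have hT : (fun p : Λ × Y => GaugeField.gaugeAct (g p.1) (Ψ p.2)) '' (univ ×ˢ s) ∈ 𝓝 U₀ := hΘ (image_mem_map (prod_mem_nhds univ_mem hs))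
  obtain ⟨r, hr, hnear⟩ := exists_orbitDist_le_imp_gaugeAct_mem F hJK U₀ (inter_mem hT hcont)
  refine ⟨r, hr, fun U hU hUr => ?_⟩
  obtain ⟨w, hw, hWT, hWc⟩ := hnear U hUr
  -- `w • U` is in the fibre (closure point + continuity of the descent)
  have hWcl := gaugeAct_mem_closure_inter F hJK hw hU
  have hWf : GaugeField.gaugeAct w U ∈ fibre F ℰp J K hJK V := mem_fibre_of_mem_closure_of_continuousAt F hJK (closure_mono inter_subset_left hWcl) hWc
  obtain ⟨⟨l, y⟩, ⟨-, hy⟩, hW⟩ := hWT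
  dsimp only at hW
  -- the slice point is a residual translate of a fibre point, hence in the fibre
  have hΨf : Ψ y ∈ fibre F ℰp J K hJK V := by
    have : GaugeField.gaugeAct ((g l)⁻¹ : Site (F.P K) 0 → Matrix.specialUnitaryGroup (Fin 2) ℂ) (GaugeField.gaugeAct w U) = Ψ y := by
      rw [← hW, gaugeAct_inv_gaugeAct]
    rw [← this]
    exact (gaugeAct_mem_fibre_iff_of_residual F hJK (residual_inv F hJK (hg l)) _ V).2 hWf
  refine ⟨y, ⟨hy, hS y hΨf⟩, w⁻¹ * g l, residual_mul F hJK (residual_inv F hJK hw) (hg l), ?_⟩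
  rw [gaugeAct_mul_eq, hW, gaugeAct_inv_gaugeAct]

end Summit.QuantumFields.YangMills.Theorems.FluctuationComparisonRegPrIntLS2BetaCoverOfGaugeSlice

end
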